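import Literature.NumberTheory.Transcendental.NCSeriesSubstitution
import Literature.NumberTheory.Transcendental.MultipleZeta
import HarnessLib

/-!
# The Ihara–Kaneko–Zagier automorphisms `Δ`, `σ`, `σ̄` of `𝔥 = R⟨⟨x, y⟩⟩` as letter substitutions

Definition file (Literature, `NumberTheory/Transcendental`), sibling of
`NCSeriesSubstitution.lean` (the substitution endomorphisms `NCSeries.subst`), written for route
KontsevichZagierPeriods/FurushoPentagon (support item `DoubleShuffleInKZ`, stmt-14665).  It records,
as LETTER IMAGES `Bool → NCSeries Bool R` (`false = x`, `true = y`, to be fed to `NCSeries.subst`),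
the automorphisms of [IharaKanekoZagier2006, §4, §6] with IKZ's formal variable `u` absorbed into
the weight grading (every `u` comes with exactly one extra letter, so `u ↦ 1` loses nothing):

* `IKZ.geom a c = Σ_m c^m a^m = (1 - c·a)^{-1}` — geometric series in one letter
  (`geom y 1 = Σ y^m` is IKZ's `(1 - yu)^{-1}`, `geom a (-1) = (1 + a)^{-1}`), with
  `geom a c = 1 + c·a·geom a c` and `(1 - c·a)·geom a c = 1`;
* `IKZ.thetaSub : a ↦ a·(1-y)^{-1}` — insertion of `y`'s after every letter; with a leading
  `(1-y)^{-1}` this is `w ↦ Σ_m y^m ш w` ([IharaKanekoZagier2006, Prop. 7]: `(1-yu)^{-1} ш w`);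
* `IKZ.deltaSub : x ↦ x(1+y)^{-1}, y ↦ (1 + x(1+y)^{-1}) y` — the automorphism `Δ_u` of
  [IharaKanekoZagier2006, Cor. 3, (4.18)] (`Δ_u(x) = x(1+yu)^{-1}`, `Δ_u(y) = y + x(1+yu)^{-1}yu`),
  for which `reg_ш((1-yu)^{-1} ∗ w₀) = Δ_u(w₀)`, (4.17) — the generating identity of the
  regularised double shuffle family [IharaKanekoZagier2006, Thm 2 (v)];
* `IKZ.sigmaSub : x ↦ x, y ↦ (1+x)^{-1} y` — the automorphism `σ = exp(Σₙ Dₙ/n)`, `σ(x) = x`,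
  `σ(y) = (1-x)^{-1}y` of [IharaKanekoZagier2006, §6] read at `u = -1`; its weight-`m` component on
  `x^{k₁-1}y⋯x^{k_n-1}y` is `(-1)^m ·` OHNO's sum `Σ_{e₁+⋯+e_n = m} x^{k₁+e₁-1}y ⋯ x^{k_n+e_n-1}y`
  [Ohno1999, Thm 1];
* `IKZ.sigmaBarSub : x ↦ x(1+y)^{-1}, y ↦ y` — `σ̄ = τ σ τ` [IharaKanekoZagier2006, §6];
* `IKZ.rhoSub : x ↦ x, y ↦ (1+x) y` — the inverse substitution `σ^{-1}` (a polynomial map);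
* `MZV.ohnoIndices s m` — OHNO's index family: the indices `(k₁+e₁, …, k_n+e_n)` with
  `e₁ + ⋯ + e_n = m` of Ohno's sum `Z(k; m) = Σ ζ(k₁+e₁,…,k_n+e_n)` [Ohno1999, Thm 1], as a list by
  Hoffman-style recursion on the index (cf. `MZV.stuffle`); Ohno's relation is
  `Z(k; m) = Z(k'; m)` for the dual index `k' = MZV.dual k`, `m ≥ 0` (duality at `m = 0`, the sum
  formula at depth one, Hoffman's relation at `m = 1`).

With these tables, IKZ's Theorem 4 (`Δ_u = exp(Σₙ (-1)ⁿ ∂ₙ uⁿ/n)`) combined with (6.2)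
(`exp(∂) = σ̄ σ^{-1}`) is the identity of substitutions `Δ ∘ σ = σ̄`, checkable on the two
generators; it, (4.16)–(4.17) and the link with Ohno's sums are proved in the route's Theorems
files (`FurushoPentagonDoubleShuffleInKZOhno*.lean`), not here.

## Deliberately NOT here

IKZ's derivations `∂ₙ`, `Dₙ`, `δ_z`, the `∗`-exponential, `Φ_z` (Prop. 2–6) and Theorems 3–4
as printed; they are not needed once `Δ`, `σ`, `σ̄` are given by their letter images.

## References

* K. Ihara, M. Kaneko, D. Zagier, *Derivation and double shuffle relations for multiple zeta
  values*, Compositio Math. 142 (2006) 307–338: §4 Prop. 7, Cor. 3, (4.16)–(4.18); §6 (`σ`, `σ̄`,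
  `τ`, Thm 3, Thm 4, (6.2)). [IharaKanekoZagier2006]
* Y. Ohno, *A generalization of the duality and sum formulas on the multiple zeta values*,
  J. Number Theory 74 (1999) 39–43, Thm 1. [Ohno1999]
-/

noncomputable section

open scoped BigOperators

namespace Literature.NumberTheory.Transcendental

universe v

/-! ## 3. Ihara–Kaneko–Zagier's automorphisms `Δ`, `σ`, `σ̄` of `𝔥 = R⟨⟨x, y⟩⟩` -/

namespace IKZ

open NCSeries

variable {R : Type v} [CommRing R]

/-- The **geometric series in one letter**: `geom a c = Σ_m c^m a^m = (1 - c·a)^{-1}`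
(coefficient `c^m` on the word `a^m`, `0` elsewhere); `geom y 1 = (1 - y)^{-1} = Σ y^m` is the
generating series of IKZ's `y^m` (their `(1 - yu)^{-1}`), `geom a (-1) = (1 + a)^{-1}`.
[cite: IharaKanekoZagier2006, §4 (4.16) ((1 - yu)^{-1})] -/
def geom (a : Bool) (c : R) : NCSeries Bool R :=
  fun v => if v = List.replicate v.length a then c ^ v.length else 0

/-- Coefficients of the geometric series. [cite: IharaKanekoZagier2006, §4 (4.16)] -/
theorem geom_apply (a : Bool) (c : R) (v : List Bool) :
    geom a c v = if v = List.replicate v.length a then c ^ v.length else 0 := rfl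

/-- `geom a c (a^m) = c^m`. [cite: IharaKanekoZagier2006, §4 (4.16)] -/
theorem geom_apply_replicate (a : Bool) (c : R) (m : ℕ) :
    geom a c (List.replicate m a) = c ^ m := by
  rw [geom_apply, List.length_replicate, if_pos rfl]

/-- The constant term of the geometric series is `1`. [cite: IharaKanekoZagier2006, §4 (4.16)] -/
@[simp] theorem geom_apply_nil (a : Bool) (c : R) : geom a c [] = 1 := by
  rw [geom_apply, List.length_nil, List.replicate_zero, if_pos rfl, pow_zero]

/-- **`geom a c = 1 + c·a·geom a c`**. [cite: IharaKanekoZagier2006, §4 (4.16)] -/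
theorem geom_eq_one_add (a : Bool) (c : R) : geom a c = 1 + c • (letter a * geom a c) := by
  funext v
  rw [NCSeries.add_apply, NCSeries.smul_apply, smul_eq_mul]
  cases v with
  | nil => rw [geom_apply_nil, one_apply_nil, letter_mul_apply_nil, mul_zero, add_zero]
  | cons b v =>
    rw [one_apply_cons, zero_add, letter_mul_apply_cons, geom_apply, geom_apply, List.length_cons,
      List.replicate_succ]
    by_cases hb : b = a
    · subst hb
      by_cases hv : v = List.replicate v.length b
      · rw [if_pos (by rw [← hv]), if_pos rfl, if_pos hv, pow_succ, mul_comm]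
      · rw [if_neg (fun h => hv (List.cons.inj h).2), if_pos rfl, if_neg hv, mul_zero]
    · rw [if_neg (fun h => hb (List.cons.inj h).1), if_neg hb, mul_zero]

/-- **`(1 - c·a) geom a c = 1`**: the geometric series is a left inverse of `1 - c·a`.
[cite: IharaKanekoZagier2006, §4 (4.16)] -/
theorem one_sub_smul_letter_mul_geom (a : Bool) (c : R) :
    (1 - c • (letter a : NCSeries Bool R)) * geom a c = 1 := by
  have h := geom_eq_one_add a c
  rw [sub_mul, one_mul, smul_mul_assoc]
  nth_rewrite 1 [h]
  exact add_sub_cancel_right _ _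

/-- `(1 + y)·(1+y)^{-1} = 1`, i.e. `(1 + a) * geom a (-1) = 1`.
[cite: IharaKanekoZagier2006, §4 (4.18)] -/
theorem one_add_letter_mul_geom (a : Bool) :
    (1 + (letter a : NCSeries Bool R)) * geom a (-1) = 1 := by
  have h := one_sub_smul_letter_mul_geom (R := R) a (-1)
  rwa [neg_smul, one_smul, sub_neg_eq_add] at h

/-- `(1 - y)·Σ y^m = 1`, i.e. `(1 - a) * geom a 1 = 1`.
[cite: IharaKanekoZagier2006, §4 (4.16)] -/
theorem one_sub_letter_mul_geom (a : Bool) :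
    (1 - (letter a : NCSeries Bool R)) * geom a 1 = 1 := by
  have h := one_sub_smul_letter_mul_geom (R := R) a 1
  rwa [one_smul] at h

/-- **`geom a c = 1 + c·(geom a c)·a`** (the letter can also be split off on the right).
[cite: IharaKanekoZagier2006, §4 (4.16)] -/
theorem geom_eq_one_add' (a : Bool) (c : R) : geom a c = 1 + c • (geom a c * letter a) := by
  funext v
  rw [NCSeries.add_apply, NCSeries.smul_apply, smul_eq_mul]
  induction v using List.reverseRecOn with
  | nil => rw [geom_apply_nil, one_apply_nil, mul_letter_apply_nil, mul_zero, add_zero]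
  | append_singleton w b _ =>
    have h1 : (1 : NCSeries Bool R) (w ++ [b]) = 0 := by cases w <;> rfl
    rw [h1, zero_add, mul_letter_apply_concat, geom_apply, geom_apply, List.length_append,
      List.length_singleton, List.replicate_succ']
    by_cases hb : b = a
    · subst hb
      by_cases hw : w = List.replicate w.length b
      · rw [if_pos (by rw [← hw]), if_pos rfl, if_pos hw, pow_succ, mul_comm]
      · rw [if_neg (fun h => hw (List.append_inj' h (by simp)).1), if_pos rfl, if_neg hw, mul_zero]
    · rw [if_neg (fun h => hb (List.singleton_inj.mp (List.append_inj' h (by simp)).2)),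
        if_neg hb, mul_zero]

/-- **`geom a c (1 - c·a) = 1`**: the geometric series is also a right inverse.
[cite: IharaKanekoZagier2006, §4 (4.16)] -/
theorem geom_mul_one_sub_smul_letter (a : Bool) (c : R) :
    geom a c * (1 - c • (letter a : NCSeries Bool R)) = 1 := by
  have h := geom_eq_one_add' a c
  rw [mul_sub, mul_one, mul_smul_comm]
  nth_rewrite 1 [h]
  exact add_sub_cancel_right _ _

/-- `(1+y)^{-1}·(1 + y) = 1`, i.e. `geom a (-1) * (1 + a) = 1`.
[cite: IharaKanekoZagier2006, §4 (4.18)] -/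
theorem geom_mul_one_add_letter (a : Bool) :
    geom a (-1) * (1 + (letter a : NCSeries Bool R)) = 1 := by
  have h := geom_mul_one_sub_smul_letter (R := R) a (-1)
  rwa [neg_smul, one_smul, sub_neg_eq_add] at h

/-- `τ(geom a c) = geom (!a) c`: reversing and exchanging the letters of a geometric series.
[cite: IharaKanekoZagier2006, §6 (τ)] -/
theorem dualSeries_geom (a : Bool) (c : R) : dualSeries (fun b => !b) (geom a c) = geom (!a) c := by
  funext v
  rw [dualSeries_apply, geom_apply, geom_apply, List.length_map, List.length_reverse]
  congr 1
  refine propext ⟨fun h => ?_, fun h => ?_⟩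
  · have := congrArg (fun l : List Bool => (l.map fun b => !b).reverse) h
    simpa [List.map_reverse, List.map_map, Function.comp_def, List.map_replicate] using this
  · rw [h]; simp [List.map_replicate]

/-- `τ(1) = 1`. [cite: IharaKanekoZagier2006, §6 (τ)] -/
theorem dualSeries_one : dualSeries (fun b => !b) (1 : NCSeries Bool R) = 1 := by
  funext v
  rw [dualSeries_apply]
  cases v with
  | nil => rfl
  | cons b v =>
    rw [one_apply_cons, List.reverse_cons, List.map_append]
    cases hv : (v.reverse.map fun b => !b) with
    | nil => rfl
    | cons d w => rfl

/-- `τ(x) = y`, `τ(y) = x`: `τ(letter a) = letter (!a)`. [cite: IharaKanekoZagier2006, §6 (τ)] -/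
theorem dualSeries_letter (a : Bool) :
    dualSeries (fun b => !b) (letter a : NCSeries Bool R) = letter (!a) := by
  funext v
  rw [dualSeries_apply, letter_apply, letter_apply]
  congr 1
  refine propext ⟨fun h => ?_, fun h => ?_⟩
  · have := congrArg (fun l : List Bool => (l.map fun b => !b).reverse) h
    simpa [List.map_reverse, List.map_map, Function.comp_def] using this
  · subst h; simp

/-- Letter images of `θ`: `a ↦ a·(1-y)^{-1}` (insert `y`'s after each letter; with a leading
`(1-y)^{-1}` this is `w ↦ Σ_m y^m ш w`, [IharaKanekoZagier2006, Prop. 7]).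
[cite: IharaKanekoZagier2006, Prop. 7] -/
def thetaSub : Bool → NCSeries Bool R := fun a => letter a * geom true 1

/-- Letter images of IKZ's **`Δ`** (weight-graded `Δ_u`): `x ↦ x(1+y)^{-1}`,
`y ↦ y + x(1+y)^{-1} y = (1 + x(1+y)^{-1}) y`. [cite: IharaKanekoZagier2006, Cor. 3 (4.18)] -/
def deltaSub : Bool → NCSeries Bool R :=
  bsub (letter false * geom true (-1)) ((1 + letter false * geom true (-1)) * letter true)

/-- Letter images of IKZ's **`σ`** at `u = -1` (Ohno's insertion of `x`'s before each `y`,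
signed): `x ↦ x`, `y ↦ (1+x)^{-1} y`.
[cite: IharaKanekoZagier2006, §6 (σ(x) = x, σ(y) = (1-x)⁻¹y)] -/
def sigmaSub : Bool → NCSeries Bool R := bsub (letter false) (geom false (-1) * letter true)

/-- Letter images of IKZ's **`σ̄ = τ σ τ`** at `u = -1`: `x ↦ x(1+y)^{-1}`, `y ↦ y`.
[cite: IharaKanekoZagier2006, §6 (σ̄ = τστ)] -/
def sigmaBarSub : Bool → NCSeries Bool R := bsub (letter false * geom true (-1)) (letter true)

/-- Letter images of **`ρ = σ^{-1}`** at `u = -1`: `x ↦ x`, `y ↦ (1+x) y` (a polynomial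
substitution). [cite: IharaKanekoZagier2006, §6 (σ)] -/
def rhoSub : Bool → NCSeries Bool R := bsub (letter false) ((1 + letter false) * letter true)

/-- The letter images of `θ` have no constant term. [cite: IharaKanekoZagier2006, Prop. 7] -/
theorem thetaSub_apply_nil (a : Bool) : (thetaSub a : NCSeries Bool R) [] = 0 := by
  rw [thetaSub, mul_apply_nil', letter_apply, if_neg (by simp), zero_mul]

/-- The letter images of `Δ` have no constant term. [cite: IharaKanekoZagier2006, Cor. 3 (4.18)] -/
theorem deltaSub_apply_nil (a : Bool) : (deltaSub a : NCSeries Bool R) [] = 0 := by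
  cases a <;> simp [deltaSub, mul_apply_nil']

/-- The letter images of `σ` have no constant term. [cite: IharaKanekoZagier2006, §6 (σ)] -/
theorem sigmaSub_apply_nil (a : Bool) : (sigmaSub a : NCSeries Bool R) [] = 0 := by
  cases a <;> simp [sigmaSub, mul_apply_nil']

/-- The letter images of `σ̄` have no constant term. [cite: IharaKanekoZagier2006, §6 (σ̄)] -/
theorem sigmaBarSub_apply_nil (a : Bool) : (sigmaBarSub a : NCSeries Bool R) [] = 0 := by
  cases a <;> simp [sigmaBarSub, mul_apply_nil']

/-- The letter images of `ρ` have no constant term. [cite: IharaKanekoZagier2006, §6 (σ)] -/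
theorem rhoSub_apply_nil (a : Bool) : (rhoSub a : NCSeries Bool R) [] = 0 := by
  cases a <;> simp [rhoSub, mul_apply_nil']

end IKZ

/-! ## 4. Ohno's index family `Z(k; m)` -/

namespace MZV

/-- **Ohno's index family**: `ohnoIndices k m` lists the indices `(k₁ + e₁, …, k_n + e_n)` over all
`e ∈ ℕⁿ` with `e₁ + ⋯ + e_n = m` (each once), so that Ohno's sum is
`Z(k; m) = Σ_{u ∈ ohnoIndices k m} ζ(u)`; recursion on the index: the first entry receives
`j ∈ {0, …, m}` and the rest receives `m - j`. [cite: Ohno1999, Thm 1 (Z(k;l))] -/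
def ohnoIndices : List ℕ → ℕ → List (List ℕ)
  | [], 0 => [[]]
  | [], _ + 1 => []
  | a :: s, m => (List.range (m + 1)).flatMap fun j => (ohnoIndices s (m - j)).map (List.cons (a + j))

/-- `Z(∅; 0)` has the single empty index. [cite: Ohno1999, Thm 1] -/
@[simp] theorem ohnoIndices_nil_zero : ohnoIndices [] 0 = [[]] := rfl

/-- `Z(∅; m+1)` is empty. [cite: Ohno1999, Thm 1] -/
@[simp] theorem ohnoIndices_nil_succ (m : ℕ) : ohnoIndices [] (m + 1) = [] := rfl

/-- The recursion of Ohno's family on the first entry. [cite: Ohno1999, Thm 1] -/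
theorem ohnoIndices_cons (a : ℕ) (s : List ℕ) (m : ℕ) :
    ohnoIndices (a :: s) m =
      (List.range (m + 1)).flatMap fun j => (ohnoIndices s (m - j)).map (List.cons (a + j)) := by
  rw [ohnoIndices]

/-- `Z(k; 0) = ζ(k)`: the only index is `k` itself. [cite: Ohno1999, Thm 1 (l = 0: duality)] -/
theorem ohnoIndices_zero : ∀ s : List ℕ, ohnoIndices s 0 = [s]
  | [] => rfl
  | a :: s => by rw [ohnoIndices_cons]; simp [ohnoIndices_zero s]

/-- Members of Ohno's family dominate the index entrywise; in particular they have its length,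
positive entries where it has, and first entry at least its first entry. [cite: Ohno1999, Thm 1] -/
theorem forall₂_le_of_mem_ohnoIndices : ∀ (s : List ℕ) (m : ℕ), ∀ u ∈ ohnoIndices s m,
    List.Forall₂ (· ≤ ·) s u
  | [], 0, u, hu => by simp at hu; subst hu; exact List.Forall₂.nil
  | [], m + 1, u, hu => by simp at hu
  | a :: s, m, u, hu => by
    rw [ohnoIndices_cons, List.mem_flatMap] at hu
    obtain ⟨j, -, hj⟩ := hu
    obtain ⟨u', hu', rfl⟩ := List.mem_map.mp hj
    exact List.Forall₂.cons (Nat.le_add_right a j) (forall₂_le_of_mem_ohnoIndices s (m - j) u' hu')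

/-- The weight of a member of `Z(k; m)` is `|k| + m`. [cite: Ohno1999, Thm 1] -/
theorem sum_of_mem_ohnoIndices : ∀ (s : List ℕ) (m : ℕ), ∀ u ∈ ohnoIndices s m, u.sum = s.sum + m
  | [], 0, u, hu => by simp at hu; subst hu; rfl
  | [], m + 1, u, hu => by simp at hu
  | a :: s, m, u, hu => by
    rw [ohnoIndices_cons, List.mem_flatMap] at hu
    obtain ⟨j, hjm, hj⟩ := hu
    obtain ⟨u', hu', rfl⟩ := List.mem_map.mp hj
    rw [List.sum_cons, List.sum_cons, sum_of_mem_ohnoIndices s (m - j) u' hu']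
    rw [List.mem_range] at hjm
    omega

/-- Members of Ohno's family of an admissible index are admissible. [cite: Ohno1999, Thm 1] -/
theorem isAdmissible_of_mem_ohnoIndices {s : List ℕ} (hs : IsAdmissible s) {m : ℕ} {u : List ℕ}
    (hu : u ∈ ohnoIndices s m) : IsAdmissible u := by
  have h := forall₂_le_of_mem_ohnoIndices s m u hu
  refine ⟨fun i hi => ?_, fun hne => ?_⟩
  · obtain ⟨k, hk, rfl⟩ := List.getElem_of_mem hi
    have hl := h.length_eq
    exact (hs.1 _ (List.getElem_mem (by omega))).trans (h.get (by omega) hk)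
  · cases h with
    | nil => exact absurd rfl hne
    | cons hab _ => exact (hs.2 (List.cons_ne_nil _ _)).trans hab

end MZV

end Literature.NumberTheory.Transcendental
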